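import Mathlib
import HarnessLib

/-!
# The diffusion caricature of open-boundary decorrelation: the reflecting-end second difference on `T` slices has the exact eigenpairs `cos(πk(x+½)/T)`, `4 sin²(πk/2T)`, and its slowest mode relaxes in time between `T²/π²` and `T²/4`

HONEST FRAMING: exact (Metropolis-corrected) sampling algorithms for lattice gauge theory;
figures of merit are autocorrelation/cost numbers at stated couplings and volumes; no
continuum-physics claim.

Venture `LatticeQCDFlow` (cell pub-lqcd), sub-topic `Scaling`; FANOUT row 21 (`su3-base`: the
third arm OBC-HMC, whose card row asks for the "CSD growth" of `τ_int(Q²)` against the open-boundary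
expectation).  NEW WORK of the cell (placement rule), Mathlib-only, elementary; no definition is
introduced; nothing is cited as a fact; no number of ours.  Printed counterpart NAMED ONLY: the
diffusion picture of topological-charge decorrelation with open boundary conditions in time
(Lüscher–Schaefer, JHEP 07 (2011) 036; McGlynn–Mawhinney, Phys. Rev. D 90 (2014) 074502): charge
enters and leaves through the two open ends and spreads diffusively, so the slowest relaxation time
grows like the SQUARE of the time extent `T` — in contrast with the periodic torus, where the total
charge is (nearly) quantised and changes only by tunnelling.

This file types the exact mathematics of the caricature and nothing more: the one-dimensional
discrete heat equation on the `T` time slices `x = 0, …, T − 1` with REFLECTING (Neumann) ends —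
the second difference in which the missing neighbour of a boundary slice is the slice itself.

## What is proved

* §1 `cos_mode_second_difference` — for every `h` and `u`,
  `cos(u − h) − 2 cos u + cos(u + h) = −(2 − 2 cos h) cos u`: the profile
  `c_k(x) = cos(πk(x + ½)/T)` satisfies the interior heat-equation eigen-relation at EVERY integer
  `x` with `λ_k = 2 − 2cos(πk/T)` (`cos_mode_interior`);
  `cos_mode_reflect_left`, `cos_mode_reflect_right` — `c_k(−1) = c_k(0)` and `c_k(T) = c_k(T − 1)`:
  the profile is its own reflection across both ends, so it satisfies the REFLECTING boundary rows
  too (`cos_mode_boundary_left`, `cos_mode_boundary_right`): `c_k` is an exact eigenvector of the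
  reflecting-end second difference with eigenvalue `λ_k = 2 − 2cos(πk/T) = 4 sin²(πk/2T)`
  (the half-angle identity is the tree's `two_sub_two_mul_cos`, used inline here).
* §2 the slowest non-constant mode `k = 1`: **`slowest_mode_rate_le`** (`λ₁ ≤ π²/T²`, `T ≥ 1`) and
  **`slowest_mode_rate_ge`** (`λ₁ ≥ 4/T²`, Jordan's inequality), hence the relaxation time
  `1/λ₁` of the caricature satisfies **`T²/π² ≤ 1/λ₁ ≤ T²/4`** (`slowest_mode_time_mem_Icc`):
  it grows like `T²` — neither faster nor slower.

NOT CLAIMED: that the topological charge of the OBC arm follows this caricature (that is the row's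
measurement); completeness of the `T` profiles as an eigenbasis; any statement about the periodic
arm.
-/

namespace Summit.Ventures.LatticeQCDFlow.Scaling

open Real

/-! ## §1 The reflecting-end eigenprofiles -/

/-- The three-point identity behind every discrete heat-equation mode:
`cos(u − h) − 2 cos u + cos(u + h) = −(2 − 2 cos h) cos u`. -/
theorem cos_mode_second_difference (u h : ℝ) :
    Real.cos (u - h) - 2 * Real.cos u + Real.cos (u + h) = -(2 - 2 * Real.cos h) * Real.cos u := by
  rw [Real.cos_sub, Real.cos_add]
  ring

/-- **Interior rows**: the profile `c(x) = cos(πk(x + ½)/T)` satisfies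
`c(x − 1) − 2 c(x) + c(x + 1) = −λ_k c(x)` with `λ_k = 2 − 2cos(πk/T)` at every real (in particular
every integer) `x`. -/
theorem cos_mode_interior (T k x : ℝ) :
    Real.cos (π * k * (x - 1 + 1 / 2) / T) - 2 * Real.cos (π * k * (x + 1 / 2) / T)
        + Real.cos (π * k * (x + 1 + 1 / 2) / T)
      = -(2 - 2 * Real.cos (π * k / T)) * Real.cos (π * k * (x + 1 / 2) / T) := by
  have h1 : π * k * (x - 1 + 1 / 2) / T = π * k * (x + 1 / 2) / T - π * k / T := by ring
  have h2 : π * k * (x + 1 + 1 / 2) / T = π * k * (x + 1 / 2) / T + π * k / T := by ring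
  rw [h1, h2]
  exact cos_mode_second_difference _ _

/-- **Left reflection**: `c(−1) = c(0)` (the profile is even about `x = −½`). -/
theorem cos_mode_reflect_left (T k : ℝ) :
    Real.cos (π * k * (-1 + 1 / 2) / T) = Real.cos (π * k * (0 + 1 / 2) / T) := by
  have h : π * k * (-1 + 1 / 2) / T = -(π * k * (0 + 1 / 2) / T) := by ring
  rw [h, Real.cos_neg]

/-- **Right reflection**: `c(T) = c(T − 1)` for a natural number `k` (the profile is even about
`x = T − ½`, because `sin(πk) = 0`). -/
theorem cos_mode_reflect_right (T : ℝ) (k : ℕ) (hT : T ≠ 0) :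
    Real.cos (π * k * (T + 1 / 2) / T) = Real.cos (π * k * (T - 1 + 1 / 2) / T) := by
  have h1 : π * k * (T + 1 / 2) / T = k * π + π * k / (2 * T) := by field_simp
  have h2 : π * k * (T - 1 + 1 / 2) / T = k * π - π * k / (2 * T) := by field_simp; ring
  rw [h1, h2, Real.cos_add, Real.cos_sub, Real.sin_nat_mul_pi]
  ring

/-- **Left boundary row** of the reflecting-end second difference: `c(1) − c(0) = −λ_k c(0)`. -/
theorem cos_mode_boundary_left (T k : ℝ) :
    Real.cos (π * k * (1 + 1 / 2) / T) - Real.cos (π * k * (0 + 1 / 2) / T)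
      = -(2 - 2 * Real.cos (π * k / T)) * Real.cos (π * k * (0 + 1 / 2) / T) := by
  have h := cos_mode_interior T k 0
  rw [show (0 : ℝ) - 1 + 1 / 2 = -1 + 1 / 2 by ring, cos_mode_reflect_left, zero_add] at h
  rw [zero_add]
  linarith

/-- **Right boundary row**: `c(T − 2) − c(T − 1) = −λ_k c(T − 1)` (natural `k`, `T ≠ 0`). -/
theorem cos_mode_boundary_right (T : ℝ) (k : ℕ) (hT : T ≠ 0) :
    Real.cos (π * k * (T - 2 + 1 / 2) / T) - Real.cos (π * k * (T - 1 + 1 / 2) / T)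
      = -(2 - 2 * Real.cos (π * k / T)) * Real.cos (π * k * (T - 1 + 1 / 2) / T) := by
  have h := cos_mode_interior T k (T - 1)
  rw [show T - 1 + 1 + 1 / 2 = T + 1 / 2 by ring, cos_mode_reflect_right T k hT,
    show T - 1 - 1 + 1 / 2 = T - 2 + 1 / 2 by ring] at h
  linarith

/-! ## §2 The slowest non-constant mode relaxes in time `Θ(T²)` -/

/-- **`λ₁ = 4 sin²(π/2T) ≤ π²/T²`** (`sin x ≤ x`). -/
theorem slowest_mode_rate_le {T : ℝ} (hT : 1 ≤ T) :
    2 - 2 * Real.cos (π / T) ≤ π ^ 2 / T ^ 2 := by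
  have two_sub : 2 - 2 * Real.cos (π / T) = 4 * Real.sin (π / T / 2) ^ 2 := by
    have h1 : Real.cos (π / T / 2) ^ 2 = 1 / 2 + Real.cos (2 * (π / T / 2)) / 2 := Real.cos_sq _
    have h2 : 2 * (π / T / 2) = π / T := by ring
    rw [h2] at h1
    have h3 := Real.sin_sq_add_cos_sq (π / T / 2)
    linarith
  rw [two_sub]
  have hT0 : 0 < T := by linarith
  have hx : 0 ≤ π / T / 2 := by positivity
  have hx' : π / T / 2 ≤ π / 2 := by
    gcongr
    exact div_le_self Real.pi_pos.le hT
  have hs : Real.sin (π / T / 2) ≤ π / T / 2 := Real.sin_le hx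
  have hs0 : 0 ≤ Real.sin (π / T / 2) :=
    Real.sin_nonneg_of_nonneg_of_le_pi hx (by linarith [Real.pi_pos])
  calc 4 * Real.sin (π / T / 2) ^ 2 ≤ 4 * (π / T / 2) ^ 2 := by gcongr
    _ = π ^ 2 / T ^ 2 := by ring

/-- **`λ₁ = 4 sin²(π/2T) ≥ 4/T²`** for `T ≥ 1` (Jordan's inequality `sin x ≥ (2/π) x` on
`[0, π/2]`). -/
theorem slowest_mode_rate_ge {T : ℝ} (hT : 1 ≤ T) :
    4 / T ^ 2 ≤ 2 - 2 * Real.cos (π / T) := by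
  have two_sub : 2 - 2 * Real.cos (π / T) = 4 * Real.sin (π / T / 2) ^ 2 := by
    have h1 : Real.cos (π / T / 2) ^ 2 = 1 / 2 + Real.cos (2 * (π / T / 2)) / 2 := Real.cos_sq _
    have h2 : 2 * (π / T / 2) = π / T := by ring
    rw [h2] at h1
    have h3 := Real.sin_sq_add_cos_sq (π / T / 2)
    linarith
  rw [two_sub]
  have hT0 : 0 < T := by linarith
  have hx : 0 ≤ π / T / 2 := by positivity
  have hx' : π / T / 2 ≤ π / 2 := by
    gcongr
    exact div_le_self Real.pi_pos.le hT
  have hs : 2 / π * (π / T / 2) ≤ Real.sin (π / T / 2) := Real.mul_le_sin hx hx'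
  have heq : 2 / π * (π / T / 2) = 1 / T := by field_simp
  rw [heq] at hs
  have h1 : 0 ≤ 1 / T := by positivity
  calc 4 / T ^ 2 = 4 * (1 / T) ^ 2 := by ring
    _ ≤ 4 * Real.sin (π / T / 2) ^ 2 := by gcongr

/-- **The relaxation time of the slowest mode is `Θ(T²)`**: `T²/π² ≤ 1/λ₁ ≤ T²/4` for `T ≥ 1`. -/
theorem slowest_mode_time_mem_Icc {T : ℝ} (hT : 1 ≤ T) :
    1 / (2 - 2 * Real.cos (π / T)) ∈ Set.Icc (T ^ 2 / π ^ 2) (T ^ 2 / 4) := by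
  have hT0 : 0 < T := by linarith
  have hlo := slowest_mode_rate_ge hT
  have hhi := slowest_mode_rate_le hT
  have hpos : 0 < 2 - 2 * Real.cos (π / T) := lt_of_lt_of_le (by positivity) hlo
  constructor
  · rw [le_div_iff₀ hpos]
    calc T ^ 2 / π ^ 2 * (2 - 2 * Real.cos (π / T)) ≤ T ^ 2 / π ^ 2 * (π ^ 2 / T ^ 2) := by gcongr
      _ = 1 := by field_simp
  · rw [div_le_iff₀ hpos]
    calc (1 : ℝ) = T ^ 2 / 4 * (4 / T ^ 2) := by field_simp
      _ ≤ T ^ 2 / 4 * (2 - 2 * Real.cos (π / T)) := by gcongr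

end Summit.Ventures.LatticeQCDFlow.Scaling
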